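import Summits.QuantumFields.BalabanUV.T4Continuum.Support.VariationalCovariantTwoRunsTaxiEnd
import Summits.QuantumFields.BalabanUV.T4Continuum.Spine.NE2VariationalTwoRunsFromNE3

/-!
# T⁴ programme, spine node NE2 (U1a), lane P2 — THE TWO-RUNS TAXI END ON NODE NE3's OWN LANDED CARRIER: `NE3Shape (minActReadings … (p2Loc L M Rt)) C θ`
# + unit phases with ONE scale-invariant plaquette class + four smallness lines ⟹ `TowerLimitRate (fun _ ↦ 1) 1 (k ↦ Δ′_k(Rt V k, nested taxi)) C (max θ L⁻¹)`
# for EVERY admissible datum `V` — NO displayed transport binder (row B6′ pattern, by name on both ends)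

NE2 formalisation swarm `b2b-balaban-t4-ne2-formalise-*`, leaf prover 09 (gen 5); supplier item (O2″) of register row «P2-sup»; the Spine companion of
`Support/VariationalCovariantTwoRunsTaxiEnd.towerLimitRate_twoRuns_taxi_of_localRate` (this lineage), exactly as `Spine/NE2VariationalTwoRunsEndFromNE3`
(p216490) is the companion of the (O2′) sockets.  Inputs BY NAME: `towerLimitRate_twoRuns_taxi_of_localRate`, leaf-09-g4's
`Spine/NE2VariationalTwoRunsFromNE3.{p2Loc, localRate_minActReadings_iff_tow}` (p214586), `Support/MinimalActionRate.minActReadings` (NE3 lineage),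
node U1b's `T4EtaRateMin.{LocalRate, NE3Shape}`.
 * **`towerLimitRate_twoRuns_taxi_of_minActReadings`** — from node U1b's local half `LocalRate (minActReadings d 𝒞 L N dom (p2Loc L M Rt)) C θ` (`0 ≤ C`,
   `0 ≤ θ < 1`): for every `V ∈ dom` whose tower `Rt V` has unit phases, the size class `α` and plaquette defects `p_k` with `(L^k)²·p_k ≤ c` (+ the four
   smallness lines on `c`, `1 ≤ d`, `2 ≤ L`, `0 < a₀`), the two-runs taxi END for `Rc := Rt V`;
 * **`towerLimitRate_twoRuns_taxi_of_ne3Shape`** — the same from the full `NE3Shape` on that carrier.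
WHAT IS LEFT (stated, not hidden): NE3's tree inhabits no local half today (route (A) = the ACTION half); whether `p2Loc` is node U1b's local deliverable is
the NE3 owner lineage's word; no B0 (the identification of `Rt V` with the (3.35)-gauge phases of Bałaban's `U_k(V)` is the b05∕b09∕an2 dictionary).

HONEST FRAMING (T4-DAG p. 1).  Bookkeeping (compositions BY NAME); `Rt` DATA; NE3 OPEN (DISPLAYED); NE2 NOT proved; model level (U(1) charged-scalar sector of
road P2; small field PER UNIT BLOCK); spine PROVED 0∕9 unchanged; rung (B)+1 finite T⁴ — NOT infinite volume, NOT a mass gap, NOT Clay.  HONEST DEPENDENCY (cell,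
verbatim): continuum YM on T⁴ ⇐ BetaPertH ∧ nine spine estimates (0/9 proved); BetaPertH ⇐ (D1) ∧ (D4) ∧ CAP+tail; G-an2-4 gates asym, D1 and NE2/3/4.
ABSOLUTE RULE kept; [folklore]; no `def`; no `def … : Prop` fact; no `sorry`; axioms standard.
-/

noncomputable section

open scoped Matrix ComplexConjugate ComplexOrder Matrix.Norms.L2Operator BigOperators

namespace Summit.QuantumFields.BalabanUV.T4Continuum.NE2VariationalTwoRunsTaxiEndFromNE3

open Literature.MathematicalPhysics.QuantumFieldTheory.Balaban1983to89
open Literature.MathematicalPhysics.QuantumFieldTheory.Balaban1983to89.B5Prop11Plancherel (Tor fine)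
open Literature.MathematicalPhysics.QuantumFieldTheory.Balaban1983to89.T4EtaRateMin (LocalRate NE3Shape)
open Summit.QuantumFields.BalabanUV.T4Continuum.VariationalCovariantEffective (effSc)
open Summit.QuantumFields.BalabanUV.T4Continuum.VariationalCovariantTwoRunsEnd (cTwoRuns)
open Summit.QuantumFields.BalabanUV.T4Continuum.VariationalCovariantTwoRunsTransport (nestOf)
open Summit.QuantumFields.BalabanUV.T4Continuum.VariationalCovariantTwoRunsSocket (cRho)
open Summit.QuantumFields.BalabanUV.T4Continuum.VariationalCovariantTwoRunsTaxiEnd (towerLimitRate_twoRuns_taxi_of_localRate)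
open Summit.QuantumFields.BalabanUV.T4Continuum.CovariantAveragingTower (TowerLimitRate)
open Summit.QuantumFields.BalabanUV.T4Continuum.VariationalTaxiTransport (plaq)
open Summit.QuantumFields.BalabanUV.T4Continuum.MinimalActionRate (minActReadings)
open Summit.QuantumFields.BalabanUV.T4Continuum.NE2VariationalTwoRunsFromNE3 (p2Loc localRate_minActReadings_iff_tow)

variable {d : ℕ} (L : ℕ) [NeZero L] (M : Fin d → ℕ) [hM : ∀ μ, NeZero (M μ)]
variable {o : Type*} [Fintype o] [DecidableEq o]

section Carrier

variable {𝒞 : ℕ → Set (B7Prop1Explicit.Site d → Fin d → (Matrix o o ℂ)ˣ)} {N : ℕ}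
  {dom : Set (B7Prop1Explicit.Site d → Fin d → (Matrix o o ℂ)ˣ)}
  {Rt : (B7Prop1Explicit.Site d → Fin d → (Matrix o o ℂ)ˣ) → ((k : ℕ) → Tor (fine (L ^ k) M) → Fin d → ℂ)} {C θ : ℝ}

/-- **THE TWO-RUNS TAXI END ON NODE NE3's CARRIER, DATUM BY DATUM** (from the local half `LocalRate` on `minActReadings … (p2Loc L M Rt)`, `0 ≤ C`,
`0 ≤ θ < 1`): for `V ∈ dom` with unit phases, size class `α`, plaquette class `(L^k)²·p_k ≤ c` and the four smallness lines,
`TowerLimitRate (fun _ ↦ 1) 1 (fun k => effSc (L^k) M (Rt V k) (nestOf L M k (Rt V k)) a₀) (cTwoRuns d L c_w′ c ((d−1)c) ((d−1)c) c_ρ (d·c_ρ)) (max θ L⁻¹)`.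
NE3 NOT discharged; NE2 NOT proved. [folklore] -/
theorem towerLimitRate_twoRuns_taxi_of_minActReadings (hd : 1 ≤ d) (hL : 2 ≤ L) {α : ℝ} (hC : 0 ≤ C) (hθ0 : 0 ≤ θ) (hθ1 : θ < 1) (hα : 0 ≤ α)
    (h : LocalRate (minActReadings d 𝒞 L N dom (p2Loc L M Rt)) C θ) {V : B7Prop1Explicit.Site d → Fin d → (Matrix o o ℂ)ˣ} (hV : V ∈ dom)
    (hR1 : ∀ k x μ, ‖Rt V k x μ‖ = 1) (hsize : ∀ k x μ, ‖((L ^ k : ℕ) : ℂ) * (Rt V k x μ - 1)‖ ≤ α)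
    {p : ℕ → ℝ} (hp0 : ∀ k, 0 ≤ p k) (hp : ∀ k x κ ν, ‖plaq (L ^ k) M (Rt V k) x κ ν - 1‖ ≤ p k)
    {c : ℝ} (hclass : ∀ k, (((L ^ k : ℕ)) : ℝ) ^ 2 * p k ≤ c)
    (hc₁ : 64 * (d : ℝ) * (((d - 1 : ℕ) : ℝ) * c) ^ 2 ≤ 1 / 2)
    (hc₂ : 2 * (d : ℝ) * (((d - 1 : ℕ) : ℝ) * c) ^ 2 + 4 * (4 * (d : ℝ) ^ 2 * c) ^ 2 ≤ 1 / 2)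
    (hc₃ : 2 * (d : ℝ) * ((L : ℝ) * (((d - 1 : ℕ) : ℝ) * c)) ^ 2 ≤ 1 / 2) (hc₄ : 4 * (d : ℝ) ^ 2 * c < 1)
    {a₀ : ℝ} (ha₀ : 0 < a₀) :
    TowerLimitRate (ι := fun _ => Tor M) (fun _ => (1 : Matrix (Tor M) (Tor M) ℂ)) 1
      (fun k => effSc (L ^ k) M (Rt V k) (nestOf L M k (Rt V k)) a₀)
      (cTwoRuns d L ((4 + ((d - 1 : ℕ) : ℝ) * c) / (1 - 4 * (d : ℝ) ^ 2 * c)) c (((d - 1 : ℕ) : ℝ) * c) (((d - 1 : ℕ) : ℝ) * c)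
        (cRho C α) ((d : ℝ) * cRho C α))
      (max θ (L : ℝ)⁻¹) :=
  towerLimitRate_twoRuns_taxi_of_localRate L M hd hL hC hθ0 hθ1 hα ((localRate_minActReadings_iff_tow L M).1 h) ⟨V, hV, rfl⟩ hR1 hsize
    hp0 hp hclass hc₁ hc₂ hc₃ hc₄ ha₀

/-- **THE SAME FROM THE FULL `NE3Shape` ON NE3's CARRIER** (its `0 ≤ θ < 1` is all the rate needs; `0 ≤ C`). [folklore] -/
theorem towerLimitRate_twoRuns_taxi_of_ne3Shape (hd : 1 ≤ d) (hL : 2 ≤ L) {α : ℝ} (hC : 0 ≤ C) (hα : 0 ≤ α)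
    (h : NE3Shape (minActReadings d 𝒞 L N dom (p2Loc L M Rt)) C θ) {V : B7Prop1Explicit.Site d → Fin d → (Matrix o o ℂ)ˣ} (hV : V ∈ dom)
    (hR1 : ∀ k x μ, ‖Rt V k x μ‖ = 1) (hsize : ∀ k x μ, ‖((L ^ k : ℕ) : ℂ) * (Rt V k x μ - 1)‖ ≤ α)
    {p : ℕ → ℝ} (hp0 : ∀ k, 0 ≤ p k) (hp : ∀ k x κ ν, ‖plaq (L ^ k) M (Rt V k) x κ ν - 1‖ ≤ p k)
    {c : ℝ} (hclass : ∀ k, (((L ^ k : ℕ)) : ℝ) ^ 2 * p k ≤ c)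
    (hc₁ : 64 * (d : ℝ) * (((d - 1 : ℕ) : ℝ) * c) ^ 2 ≤ 1 / 2)
    (hc₂ : 2 * (d : ℝ) * (((d - 1 : ℕ) : ℝ) * c) ^ 2 + 4 * (4 * (d : ℝ) ^ 2 * c) ^ 2 ≤ 1 / 2)
    (hc₃ : 2 * (d : ℝ) * ((L : ℝ) * (((d - 1 : ℕ) : ℝ) * c)) ^ 2 ≤ 1 / 2) (hc₄ : 4 * (d : ℝ) ^ 2 * c < 1)
    {a₀ : ℝ} (ha₀ : 0 < a₀) :
    TowerLimitRate (ι := fun _ => Tor M) (fun _ => (1 : Matrix (Tor M) (Tor M) ℂ)) 1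
      (fun k => effSc (L ^ k) M (Rt V k) (nestOf L M k (Rt V k)) a₀)
      (cTwoRuns d L ((4 + ((d - 1 : ℕ) : ℝ) * c) / (1 - 4 * (d : ℝ) ^ 2 * c)) c (((d - 1 : ℕ) : ℝ) * c) (((d - 1 : ℕ) : ℝ) * c)
        (cRho C α) ((d : ℝ) * cRho C α))
      (max θ (L : ℝ)⁻¹) :=
  towerLimitRate_twoRuns_taxi_of_minActReadings L M hd hL hC h.rate_nonneg h.rate_lt_one hα h.pointwise hV hR1 hsize hp0 hp hclass
    hc₁ hc₂ hc₃ hc₄ ha₀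

end Carrier

end Summit.QuantumFields.BalabanUV.T4Continuum.NE2VariationalTwoRunsTaxiEndFromNE3

end
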